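import Summits.ABC.IUTFork.Repair.EvalRealProfile
import Summits.ABC.IUTFork.Repair.EvalHonestCeilingL01
import Summits.ABC.IUTFork.Cor312ProvKIdeles
import HarnessLib

/-!
# IUT REPAIR branch, §A at PRINT'S OWN K-LEVEL PILOT DATUM — hypothesis-free cells (abc-iut-rp-cx, gen 2)

PROOF-ONLY record file (no definition, no `Prop` fact; inputs consumed BY NAME) of the abc-iut cell, IUT REPAIR branch (rung
LADDER-ABC:A2.RP; lead abc-iut-rp-plan), seat abc-iut-rp-cx (refuter; T-b/T-c engine). TAKES NO SIDE on [IUTchIII] Cor. 3.12 or on any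
author (Mochizuki / Scholze–Stix / Joshi / Dupuy–Hilado); candidates are hypotheses H with «H ∧ interface ⊢ Cor 3.12» as the target shape;
typed ≠ proved; refuted-AS-TYPED ≠ refuted-in-print.

WHY. The T-c vacuity audit of the REAL column (this seat, 2026-08-26): cells at the print-normalised sharp real setting
`Real.settingPrVolSharp X …` that bind the three pins `PinnedRegions3 … ρ qK` hold VACUOUSLY at `X = pilotDataOfK D L` AS TYPED under DH's
(Ind2) (abc-iut-rp-s1 `ObstructionSS19.not_pinnedRegions3_settingPrVolSharp_pilotDataOfK`); «content-bearing genuine-data negatives are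
the PIN-FREE ones». This file records that the cx REAL cells ARE content-bearing at print's own data: at the `K`-level pilot datum
`pilotDataOfK D K` of EVERY initial Θ-datum `D` ([IUTchI] Def. 3.1), with the realising Θ- and q-ideles CHOSEN by abc-iut's existence theorems
`Cor312Prov.exists_realising_thetaIdeles_pilotDataOfK` / `exists_realising_qIdeles_pilotDataOfK` ([IUTchI] Ex. 3.2 (iv)), the §A rows
* RP-X04a («the q-pilot's image lies in the (Ind3)-Θ-region», `CandExplicit4.H`) — `x04_false_pilotDataOfK`, and
* RP-L01 (reading-3 equality with ONE possible image, `CandLana1.H`, for EVERY region reading `ρ` and `qK`) — `l01_false_pilotDataOfK`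
are FALSE with NO hypothesis left beyond the context binders (number field `M`, archimedean packets, `Ψ`, `act`, `Mmod`, `region`, columns,
lattice / signature / splitting / q-pilot context data, an analytic `logv`): the antecedents `ht0 / ht1 / ht` and `htq0 / htq1 / htq` of
`EvalRealProfile.x04_false_settingPrVolSharp` (p436945) and `EvalHonestCeilingL01.l01_false_settingPrVolSharp` (p438057) are discharged by
`choose_spec`. So these two §A cells are NON-VACUOUS at genuine data in the strongest sense the tree offers (no pin, no idele hypothesis).
What this is NOT: a statement about print's Cor. 3.12 — the rows are CANDIDATE readings (hypotheses of the repair programme), refuted AS TYPED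
on the typed interface; no judgement on any author. [cite: Mochizuki2012, IUTchI Def. 3.1, Ex. 3.2 (iv) p. 71] [cite: DupuyHilado2025, §3.3–§3.4]
[cite: ScholzeStix2018, §2.2 pp. 9–10]
-/

noncomputable section

open Set Function NumberField IsDedekindDomain

namespace Summit.ABC.IUTFork.Repair.EvalRealGenuine

open Thm311 Thm311.Real Cor312 Cor312Vol Cor312Prov Literature.IUT.LogThetaLattice Literature.IUT.LogVolume
  Literature.IUT.HodgeTheaters

variable {F K Fbar : Type} [Field F] [NumberField F] [Field K] [NumberField K] [Algebra F K] [Field Fbar]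
  [Algebra F Fbar] [Algebra K Fbar] {E : WeierstrassCurve F} [E.IsElliptic] {l : ℕ} {Pb : BadPlacePredicates K}
  (D : InitialThetaData F K Fbar E l Pb) {logv : PadicLogs K} (hlog : LogvAnalytic logv)
  (M : Type) [Field M] [NumberField M]
  (archPk : ∀ (j : (thetaIndex (pilotDataOfK D K)).Label) (vQ : (thetaIndex (pilotDataOfK D K)).VQ),
    Set ((logShellsDH (pilotDataOfK D K) logv).Packet j vQ))
  (archSub : ∀ (j : (thetaIndex (pilotDataOfK D K)).Label) (v : (thetaIndex (pilotDataOfK D K)).V),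
    Set ((logShellsDH (pilotDataOfK D K) logv).Packet j ((thetaIndex (pilotDataOfK D K)).over v)))
  (Ψ : ℤ → ∀ v : (thetaIndex (pilotDataOfK D K)).V, v ∈ (thetaIndex (pilotDataOfK D K)).Vbad →
    Set ((logShellsDH (pilotDataOfK D K) logv).StarPacket v))
  (act : ℤ → ∀ v : (thetaIndex (pilotDataOfK D K)).V, v ∈ (thetaIndex (pilotDataOfK D K)).Vbad →
    (logShellsDH (pilotDataOfK D K) logv).StarPacket v →
      Module.End ℚ ((logShellsDH (pilotDataOfK D K) logv).StarPacket v))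
  (Mmod : ℤ → ∀ j : (thetaIndex (pilotDataOfK D K)).LabelStar,
    Set ((logShellsDH (pilotDataOfK D K) logv).GlobalPacket j.1))
  (region : ℤ → ∀ j : (thetaIndex (pilotDataOfK D K)).LabelStar, FinDivisor M →
    ∀ vQ : (thetaIndex (pilotDataOfK D K)).VQ, Set ((logShellsDH (pilotDataOfK D K) logv).Packet j.1 vQ))
  (col : ℤ → Column (logShellsDH (pilotDataOfK D K) logv))
  (n : ℤ) {HT : Type} {LogLink : HT → HT → Type} {IsFull : ∀ {s t : HT}, LogLink s t → Prop}
  (lat : LGPGaussianLogThetaLattice LogLink IsFull)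
  {Frd : Type} {IsoF : Frd → Frd → Type} {Ob : Frd → Type} {realify : Frd → Frd} {Strip : Type}
  {IsoS : Strip → Strip → Type}
  {Mv : ∀ v : (thetaIndex (pilotDataOfK D K)).V, v ∈ (thetaIndex (pilotDataOfK D K)).Vbad → Type}
  [∀ v h, Monoid (Mv v h)]
  (sig : GlobalLGPFrobenioidSignature (thetaIndex (pilotDataOfK D K)).lstar (thetaIndex (pilotDataOfK D K)).V
    (· ∈ (thetaIndex (pilotDataOfK D K)).Vbad) Frd IsoF Ob realify Strip IsoS Mv)
  (split : SplittingMonoids Mv) {ObΔ : Type}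
  {N : ∀ v : (thetaIndex (pilotDataOfK D K)).V, v ∈ (thetaIndex (pilotDataOfK D K)).Vbad → Type}
  [∀ v h, Monoid (N v h)] (qData : QPilotData ObΔ N)

/-- **RP-X04a is FALSE at print's own `K`-level pilot datum of EVERY initial Θ-datum, hypothesis-free**: the REAL cell
`EvalRealProfile.x04_false_settingPrVolSharp` at `X := pilotDataOfK D K` with the realising Θ- and q-ideles chosen by
`exists_realising_thetaIdeles_pilotDataOfK` / `exists_realising_qIdeles_pilotDataOfK`; PIN-FREE, so not in the scope of the SS19 vacuity
guard. A cell on the typed interface; no judgement on print. [cite: Mochizuki2012, IUTchI Ex. 3.2 (iv) p. 71] [cite: DupuyHilado2025, §3.4] -/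
theorem x04_false_pilotDataOfK :
    ¬ CandExplicit4.H
        (LatticeSituation.mk (situationPrVol (pilotDataOfK D K) hlog M archPk archSub Ψ act Mmod region) col)
        (settingPrVolSharp (pilotDataOfK D K) hlog M archPk archSub Ψ act Mmod region n lat sig split qData
          (exists_realising_qIdeles_pilotDataOfK D).choose (exists_realising_thetaIdeles_pilotDataOfK D).choose
          (exists_realising_qIdeles_pilotDataOfK D).choose_spec.1 (exists_realising_qIdeles_pilotDataOfK D).choose_spec.2.1) :=
  EvalRealProfile.x04_false_settingPrVolSharp (pilotDataOfK D K) hlog M archPk archSub Ψ act Mmod region col n lat sig split qData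
    (exists_realising_thetaIdeles_pilotDataOfK D).choose (exists_realising_qIdeles_pilotDataOfK D).choose
    (exists_realising_thetaIdeles_pilotDataOfK D).choose_spec.1 (exists_realising_thetaIdeles_pilotDataOfK D).choose_spec.2.2
    (exists_realising_thetaIdeles_pilotDataOfK D).choose_spec.2.1 (exists_realising_qIdeles_pilotDataOfK D).choose_spec.1
    (exists_realising_qIdeles_pilotDataOfK D).choose_spec.2.1 (exists_realising_qIdeles_pilotDataOfK D).choose_spec.2.2

/-- **RP-L01 is FALSE at print's own `K`-level pilot datum of EVERY initial Θ-datum, for EVERY region reading `ρ` and `qK`,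
hypothesis-free**: the REAL cell `EvalHonestCeilingL01.l01_false_settingPrVolSharp` at `X := pilotDataOfK D K` with the chosen realising
ideles; PIN-FREE. A cell on the typed interface; no judgement on print. [cite: Mochizuki2012, IUTchI Ex. 3.2 (iv) p. 71] [cite: DupuyHilado2025, §3.4] -/
theorem l01_false_pilotDataOfK
    (ρ : (∀ v : (thetaIndex (pilotDataOfK D K)).V, v ∈ (thetaIndex (pilotDataOfK D K)).Vbad →
        Set ((logShellsDH (pilotDataOfK D K) logv).StarPacket v)) →
      ∀ (j : (thetaIndex (pilotDataOfK D K)).Label) (vQ : (thetaIndex (pilotDataOfK D K)).VQ),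
        Set ((logShellsDH (pilotDataOfK D K) logv).Packet j vQ))
    (qK : ∀ v : (thetaIndex (pilotDataOfK D K)).V, v ∈ (thetaIndex (pilotDataOfK D K)).Vbad →
      Set ((logShellsDH (pilotDataOfK D K) logv).StarPacket v)) :
    ¬ CandLana1.H
        (LatticeSituation.mk (situationPrVol (pilotDataOfK D K) hlog M archPk archSub Ψ act Mmod region) col)
        (settingPrVolSharp (pilotDataOfK D K) hlog M archPk archSub Ψ act Mmod region n lat sig split qData
          (exists_realising_qIdeles_pilotDataOfK D).choose (exists_realising_thetaIdeles_pilotDataOfK D).choose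
          (exists_realising_qIdeles_pilotDataOfK D).choose_spec.1 (exists_realising_qIdeles_pilotDataOfK D).choose_spec.2.1) ρ qK :=
  EvalHonestCeilingL01.l01_false_settingPrVolSharp (pilotDataOfK D K) hlog M archPk archSub Ψ act Mmod region col n lat sig split
    qData (exists_realising_thetaIdeles_pilotDataOfK D).choose (exists_realising_qIdeles_pilotDataOfK D).choose
    (exists_realising_thetaIdeles_pilotDataOfK D).choose_spec.1 (exists_realising_thetaIdeles_pilotDataOfK D).choose_spec.2.2
    (exists_realising_thetaIdeles_pilotDataOfK D).choose_spec.2.1 (exists_realising_qIdeles_pilotDataOfK D).choose_spec.1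
    (exists_realising_qIdeles_pilotDataOfK D).choose_spec.2.1 (exists_realising_qIdeles_pilotDataOfK D).choose_spec.2.2 ρ qK

end Summit.ABC.IUTFork.Repair.EvalRealGenuine

end
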